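import Mathlib.Tactic.LinearCombination
import Summits.HodgeConjecture.CorCM.Census.QuarticInversionFunctionals

/-!
# The quartic inversion twists, XII: the marginal functionals and the four-plus-one relations among the functional values

COR-CM (cell `pub-hodgecm2`, stage 2 of the Hodge ladder), count-neutral KERNEL COMBINATORICS by the binder seat b23 (gen 44; claim
QUARTIC-INVERSION, HOME/INBOX.md l.12829).  Part XII of the lane `Census/QuarticInversion*`, on top of parts I–VII and seat b09's slice
(`coef`, `hodge`, `mem_hodge_iff`), all BY NAME.  Bookkeeping definitions with bodies (`upI`, `nUp`, `wLL`, `wD`) + theorems; no `Prop`-valued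
definition, no `decide` beyond closed identities in `ZMod 2`/`Bool`, no certificate, no named fact, no geometry, no `sorry`.  `Interfaces.lean` (C1),
every E term, B01, `Transposition/*`, `PortJoin/*` untouched.
HONEST FRAMING: `HC_CM` is NOT proved, here or anywhere in the tree; nothing here is a period, a count of record or a headline.

CONTENT (`|B|` odd).  The values `fnl w x` of the pair-odd functionals of part VII on a HODGE vector `x` are not free: this file proves the
relations the closing lattice of parts XIII–XIV is cut out by, each with an explicit certificate in the slice marginal functionals.
* §1 `λ_{k,t}(x) = Σ_Θ x(Θ)·coef (0,t) (coord k Θ) = coef (0,t) ⬝ᵥ sliceMarg k x` VANISHES on `hodge₄` (`sum_mul_coef_coord_eq_zero`).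
* §2 Pointwise certificates: `2·(wUp j s Θ − wUp j s Θ̄) = 2·[c_j up] − 1 + coef (0,s) (c_j Θ)`; `wLL a b Θ − wLL a b Θ̄ = 1 − [c_a up] − [c_b up]`;
  `wD Θ − wD Θ̄ = #up(Θ) − 2`.
* §3 THE RELATIONS, for `x ∈ hodge₄`: the **column relation** `fnl (wUp j s) x = fnl (wUp j s') x` (`fnl_wUp_eq`); the **pair relations**
  `fnl (wUp a s) x + fnl (wUp b s') x + fnl (wLL a b) x = 0` (`fnl_pair_rel`; used for `(a,b) = (0,1),(0,2),(0,3)`); the **diagonal relation**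
  `Σ_j fnl (wUp j (s j)) x = fnl wD x` (`fnl_diag_rel`).  Part XIII rewrites `wUp j s = Σ_{η : η j = false} wA j η s`, `wLL a b = Σ_{η a = η b = true} wC η`,
  `wD = Σ_{η 0 = true} (#{n | η n = false} − 2)·wC η`, turning these into the relations `R1–R4` of the closing lattice.  All [folklore].

## References
* [Pohlmann1968] H. Pohlmann, Algebraic cycles on abelian varieties of complex multiplication type, Ann. of Math. 88 (1968), Thm 1.
-/

namespace Summit.HodgeConjecture.CorCM.Census.QuarticInversion

open Finset
open Summit.HodgeConjecture.CorCM.Census.OddSliceFacesModel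

noncomputable section

variable (A : Type) [AddCommGroup A] [Fintype A] [DecidableEq A]

/-! ## §1 The slice marginal functionals vanish on Hodge vectors -/

omit [AddCommGroup A] in
/-- `f ⬝ᵥ sliceMarg k x = Σ_Θ x(Θ)·f(coord k Θ)`. [folklore] -/
theorem dotProduct_sliceMarg (f : Ty A → ℤ) (k : Fin 4) (x : Ty₄ A → ℤ) :
    f ⬝ᵥ sliceMarg A k x = ∑ Θ, x Θ * f (coord A k Θ) := by
  conv_lhs => rw [← Finset.univ_sum_single x]
  rw [map_sum, dotProduct_sum]
  refine Finset.sum_congr rfl fun Θ _ => ?_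
  rw [sliceMarg_single, dotProduct_single, mul_comm]

omit [AddCommGroup A] in
/-- **The marginal functionals vanish on Hodge vectors**: `Σ_Θ x(Θ)·coef (0,t) (coord k Θ) = 0` for `x ∈ hodge₄`. [cite: Pohlmann1968, Thm 1] -/
theorem sum_mul_coef_coord_eq_zero {x : Ty₄ A → ℤ} (hx : x ∈ hodge₄ A) (k : Fin 4) (t : A) :
    ∑ Θ, x Θ * coef A (0, t) (coord A k Θ) = 0 := by
  rw [← dotProduct_sliceMarg]
  exact (mem_hodge_iff A _).mp ((mem_hodge₄_iff_sliceMarg A x).mp hx k) t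

omit [AddCommGroup A] in
/-- The defining sum of `fnl`. [folklore] -/
theorem fnl_apply (w v : Ty₄ A → ℤ) : fnl A w v = ∑ Θ, v Θ * (w Θ - w (conj₄ A Θ)) := rfl

/-! ## §2 The weights of the relations and their pointwise certificates -/

/-- `[ψ is up]` as an integer. [folklore] -/
def upI (ψ : Ty A) : ℤ := if half A ψ = false then 1 else 0

/-- The number of up coordinates of a quadruple. [folklore] -/
def nUp (Θ : Ty₄ A) : ℤ := ∑ j, upI A (coord A j Θ)

/-- **The low-low weight** `[c_a low ∧ c_b low]`. [folklore] -/
def wLL (a b : Fin 4) (Θ : Ty₄ A) : ℤ := if half A (coord A a Θ) = true ∧ half A (coord A b Θ) = true then 1 else 0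

/-- **The diagonal weight** `[c_0 low]·(#up − 2)`. [folklore] -/
def wD (Θ : Ty₄ A) : ℤ := if half A (coord A 0 Θ) = true then nUp A Θ - 2 else 0

omit [AddCommGroup A] [DecidableEq A] in
/-- `[ψ + 𝟙 up] = 1 − [ψ up]` (`|B|` odd). [folklore] -/
theorem upI_add_one (hA : Odd (Fintype.card A)) (ψ : Ty A) : upI A (ψ + 1) = 1 - upI A ψ := by
  unfold upI
  rw [half_add_one A hA]
  cases half A ψ <;> simp

omit [AddCommGroup A] [DecidableEq A] in
/-- **Certificate of the atom column**: `2·(wUp j s Θ − wUp j s Θ̄) = 2·[c_j up] − 1 + coef (0,s) (c_j Θ)`. [folklore] -/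
theorem two_mul_wUp_sub (hA : Odd (Fintype.card A)) (j : Fin 4) (s : A) (Θ : Ty₄ A) :
    2 * (wUp A j s Θ - wUp A j s (conj₄ A Θ)) = 2 * upI A (coord A j Θ) - 1 + coef A (0, s) (coord A j Θ) := by
  unfold wUp upI coef
  rw [coord_conj₄, half_add_one A hA, Pi.add_apply, Pi.one_apply]
  have h01 : ∀ u : ZMod 2, u = 0 ∨ u = 1 := by decide
  have h11 : (1 : ZMod 2) + 1 = 0 := by decide
  rcases h01 (coord A j Θ s) with h | h <;> cases half A (coord A j Θ) <;> simp [h, h11]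

omit [AddCommGroup A] [DecidableEq A] in
/-- **Certificate of the low-low weight**: `wLL a b Θ − wLL a b Θ̄ = 1 − [c_a up] − [c_b up]`. [folklore] -/
theorem wLL_sub (hA : Odd (Fintype.card A)) (a b : Fin 4) (Θ : Ty₄ A) :
    wLL A a b Θ - wLL A a b (conj₄ A Θ) = 1 - upI A (coord A a Θ) - upI A (coord A b Θ) := by
  unfold wLL upI
  rw [coord_conj₄, coord_conj₄, half_add_one A hA, half_add_one A hA]
  cases half A (coord A a Θ) <;> cases half A (coord A b Θ) <;> simp

omit [AddCommGroup A] [DecidableEq A] in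
/-- `#up(Θ̄) = 4 − #up(Θ)`. [folklore] -/
theorem nUp_conj₄ (hA : Odd (Fintype.card A)) (Θ : Ty₄ A) : nUp A (conj₄ A Θ) = 4 - nUp A Θ := by
  unfold nUp
  simp only [coord_conj₄, upI_add_one A hA, Finset.sum_sub_distrib, Finset.sum_const, Finset.card_univ, Fintype.card_fin]
  simp

omit [AddCommGroup A] [DecidableEq A] in
/-- `#up(Θ) = [c_0 up] + [c_1 up] + [c_2 up] + [c_3 up]`. [folklore] -/
theorem nUp_eq (Θ : Ty₄ A) : nUp A Θ = upI A (coord A 0 Θ) + upI A (coord A 1 Θ) + upI A (coord A 2 Θ) + upI A (coord A 3 Θ) := by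
  unfold nUp; rw [Fin.sum_univ_four]

omit [AddCommGroup A] [DecidableEq A] in
/-- **Certificate of the diagonal weight**: `wD Θ − wD Θ̄ = #up(Θ) − 2`. [folklore] -/
theorem wD_sub (hA : Odd (Fintype.card A)) (Θ : Ty₄ A) : wD A Θ - wD A (conj₄ A Θ) = nUp A Θ - 2 := by
  unfold wD
  rw [nUp_conj₄ A hA, coord_conj₄, half_add_one A hA]
  cases half A (coord A 0 Θ)
  · simp; ring
  · simp

/-! ## §3 The relations -/

omit [AddCommGroup A] in
/-- **The column relation**: `fnl (wUp j s) x` does not depend on the slot `s` (`x ∈ hodge₄`). [folklore] -/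
theorem fnl_wUp_eq (hA : Odd (Fintype.card A)) {x : Ty₄ A → ℤ} (hx : x ∈ hodge₄ A) (j : Fin 4) (s s' : A) :
    fnl A (wUp A j s) x = fnl A (wUp A j s') x := by
  have key : ∀ Θ, 2 * (x Θ * (wUp A j s Θ - wUp A j s (conj₄ A Θ))) - 2 * (x Θ * (wUp A j s' Θ - wUp A j s' (conj₄ A Θ))) =
      x Θ * coef A (0, s) (coord A j Θ) - x Θ * coef A (0, s') (coord A j Θ) := by
    intro Θ
    linear_combination (x Θ) * two_mul_wUp_sub A hA j s Θ - (x Θ) * two_mul_wUp_sub A hA j s' Θ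
  have e : 2 * fnl A (wUp A j s) x - 2 * fnl A (wUp A j s') x =
      ∑ Θ, x Θ * coef A (0, s) (coord A j Θ) - ∑ Θ, x Θ * coef A (0, s') (coord A j Θ) := by
    rw [fnl_apply, fnl_apply, Finset.mul_sum, Finset.mul_sum, ← Finset.sum_sub_distrib, ← Finset.sum_sub_distrib]
    exact Finset.sum_congr rfl fun Θ _ => key Θ
  rw [sum_mul_coef_coord_eq_zero A hx, sum_mul_coef_coord_eq_zero A hx, sub_zero] at e
  omega

omit [AddCommGroup A] in
/-- **The pair relations**: `fnl (wUp a s) x + fnl (wUp b s') x + fnl (wLL a b) x = 0` (`x ∈ hodge₄`). [folklore] -/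
theorem fnl_pair_rel (hA : Odd (Fintype.card A)) {x : Ty₄ A → ℤ} (hx : x ∈ hodge₄ A) (a b : Fin 4) (s s' : A) :
    fnl A (wUp A a s) x + fnl A (wUp A b s') x + fnl A (wLL A a b) x = 0 := by
  have key : ∀ Θ, 2 * (x Θ * (wUp A a s Θ - wUp A a s (conj₄ A Θ))) + 2 * (x Θ * (wUp A b s' Θ - wUp A b s' (conj₄ A Θ))) +
      2 * (x Θ * (wLL A a b Θ - wLL A a b (conj₄ A Θ))) = x Θ * coef A (0, s) (coord A a Θ) + x Θ * coef A (0, s') (coord A b Θ) := by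
    intro Θ
    linear_combination (x Θ) * two_mul_wUp_sub A hA a s Θ + (x Θ) * two_mul_wUp_sub A hA b s' Θ + 2 * (x Θ) * wLL_sub A hA a b Θ
  have e : 2 * fnl A (wUp A a s) x + 2 * fnl A (wUp A b s') x + 2 * fnl A (wLL A a b) x =
      ∑ Θ, x Θ * coef A (0, s) (coord A a Θ) + ∑ Θ, x Θ * coef A (0, s') (coord A b Θ) := by
    rw [fnl_apply, fnl_apply, fnl_apply, Finset.mul_sum, Finset.mul_sum, Finset.mul_sum, ← Finset.sum_add_distrib,
      ← Finset.sum_add_distrib, ← Finset.sum_add_distrib]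
    exact Finset.sum_congr rfl fun Θ _ => key Θ
  rw [sum_mul_coef_coord_eq_zero A hx, sum_mul_coef_coord_eq_zero A hx, add_zero] at e
  omega

omit [AddCommGroup A] in
/-- **The diagonal relation**: `Σ_j fnl (wUp j (s j)) x = fnl wD x` (`x ∈ hodge₄`). [folklore] -/
theorem fnl_diag_rel (hA : Odd (Fintype.card A)) {x : Ty₄ A → ℤ} (hx : x ∈ hodge₄ A) (s : Fin 4 → A) :
    fnl A (wUp A 0 (s 0)) x + fnl A (wUp A 1 (s 1)) x + fnl A (wUp A 2 (s 2)) x + fnl A (wUp A 3 (s 3)) x = fnl A (wD A) x := by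
  have key : ∀ Θ, 2 * (x Θ * (wUp A 0 (s 0) Θ - wUp A 0 (s 0) (conj₄ A Θ))) + 2 * (x Θ * (wUp A 1 (s 1) Θ - wUp A 1 (s 1) (conj₄ A Θ))) +
      2 * (x Θ * (wUp A 2 (s 2) Θ - wUp A 2 (s 2) (conj₄ A Θ))) + 2 * (x Θ * (wUp A 3 (s 3) Θ - wUp A 3 (s 3) (conj₄ A Θ))) -
      2 * (x Θ * (wD A Θ - wD A (conj₄ A Θ))) =
      x Θ * coef A (0, s 0) (coord A 0 Θ) + x Θ * coef A (0, s 1) (coord A 1 Θ) + x Θ * coef A (0, s 2) (coord A 2 Θ) +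
        x Θ * coef A (0, s 3) (coord A 3 Θ) := by
    intro Θ
    linear_combination (x Θ) * two_mul_wUp_sub A hA 0 (s 0) Θ + (x Θ) * two_mul_wUp_sub A hA 1 (s 1) Θ +
      (x Θ) * two_mul_wUp_sub A hA 2 (s 2) Θ + (x Θ) * two_mul_wUp_sub A hA 3 (s 3) Θ - 2 * (x Θ) * wD_sub A hA Θ -
      2 * (x Θ) * nUp_eq A Θ
  have e : 2 * fnl A (wUp A 0 (s 0)) x + 2 * fnl A (wUp A 1 (s 1)) x + 2 * fnl A (wUp A 2 (s 2)) x + 2 * fnl A (wUp A 3 (s 3)) x -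
      2 * fnl A (wD A) x =
      ∑ Θ, x Θ * coef A (0, s 0) (coord A 0 Θ) + ∑ Θ, x Θ * coef A (0, s 1) (coord A 1 Θ) + ∑ Θ, x Θ * coef A (0, s 2) (coord A 2 Θ) +
        ∑ Θ, x Θ * coef A (0, s 3) (coord A 3 Θ) := by
    rw [fnl_apply, fnl_apply, fnl_apply, fnl_apply, fnl_apply, Finset.mul_sum, Finset.mul_sum, Finset.mul_sum, Finset.mul_sum,
      Finset.mul_sum, ← Finset.sum_add_distrib, ← Finset.sum_add_distrib, ← Finset.sum_add_distrib, ← Finset.sum_sub_distrib,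
      ← Finset.sum_add_distrib, ← Finset.sum_add_distrib, ← Finset.sum_add_distrib]
    exact Finset.sum_congr rfl fun Θ _ => key Θ
  rw [sum_mul_coef_coord_eq_zero A hx, sum_mul_coef_coord_eq_zero A hx, sum_mul_coef_coord_eq_zero A hx,
    sum_mul_coef_coord_eq_zero A hx, add_zero, add_zero, add_zero] at e
  omega

end

end Summit.HodgeConjecture.CorCM.Census.QuarticInversion
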